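import Literature.Probability.LatticeModels.IsingThermodynamics
import Literature.Probability.LatticeModels.IsingPeierlsFlip
import Literature.Probability.LatticeModels.CurrentsEdgeAvoidance
import HarnessLib

/-!
# Disorder (twist) insertions in the plus state: `disorderWeight`, `twistedPlusExpect`

Topic `Probability/LatticeModels`, namespace `Literature.Probability.LatticeModels`
(definition request `defn-twistedPlusExpect` of route `LinkingParityCircles`,
`Summits/CriticalPhenomena/Ising3DConformalLimit`).

For the nearest-neighbour Ising model on `ℤ^d` and a finite set `S` of lattice bonds, written in
the *directed* representation `b = (a, i) ↦ {a, a + eᵢ}` (`S : Finset (Site d × Fin d)`; every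
such pair is a genuine bond of `zdGraph d`, so no `edgeSet` side condition is ever needed):

* `disorderWeight S β σ = exp (-2β ∑_{(a,i) ∈ S} σ_a σ_{a+eᵢ})` — the Boltzmann factor `w_S`
  that FLIPS the couplings on the bonds of `S` (`e^{+β σ_b} ↦ e^{-β σ_b}`, i.e. `K ↦ -K` on `S`,
  Kadanoff–Ceva 1971, §II.A, eq. (2.2)); its expectation `⟨w_S⟩ = Z{K̃}/Z{K}` is Kadanoff–Ceva's
  disorder correlation (eq. (2.3), `d = 2`, `S` = the bonds crossed by a dual path); in `d = 3`
  with `S` the bonds crossing a surface it inserts the twist / monodromy line defect of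
  Billó et al. (2013), §3 ("flip the sign of the spin-spin interaction for edges which cross
  `S`"); Wegner (1971) for the general `ℤ₂` duality picture;
* `twistedPlusExpect d β h S f = ⟨f · w_S⟩⁺_{β,h} / ⟨w_S⟩⁺_{β,h}` — the expectation of `f` in the
  plus state with the couplings on `S` flipped (a ratio of two `plusExpect`s, i.e. of two
  `limUnder`s along boxes; junk-valued exactly when `plusExpect` is);
* `bondCoboundary B` — the directed bonds with exactly one endpoint in the finite set `B`
  (the edge coboundary `δB`), and `latticeBond : Site d × Fin d → Sym2 (Site d)`.

Usage (route `LinkingParityCircles`): with `D` the flat disc of vertical bonds,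
`S := D.image fun p : ℤ × ℤ => ((![p.1, p.2, 0] : Site 3), (2 : Fin 3))`, the weight-free
order–disorder ratio is `G(x, y) = twistedPlusExpect 3 β 0 S (spinPair x y) / plusExpect 3 β 0
(spinPair x y)` and the twisted energy density is `twistedPlusExpect 3 β 0 S (J_b σ_b)`.

## Results (all proved)

* the elementary loop / plaquette identity `w_{{b}} = cosh 2β - sinh 2β · σ_b` and the product
  form `w_S = ∏_{b ∈ S} (cosh 2β - sinh 2β · σ_b)` (`disorderWeight_singleton`,
  `disorderWeight_eq_prod`);
* **gauge invariance** (Kadanoff–Ceva 1971, §II.A, "the result is independent of the path";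
  Billó et al. 2013, §3: "we can deform `S` to `S'` by flipping all the spins in the region
  between `S` and `S'`"): for every finite `B ⊆ ℤ^d`,
  `⟨f⟩_S = ⟨f ∘ flipOn B⟩_{S ∆ δB}` at `h = 0` (`twistedPlusExpect_eq_comp_flipOn`, and the
  hypothesis form `S ∆ S' = δB ⇒ ⟨f⟩_S = ⟨f ∘ flipOn B⟩_{S'}`,
  `twistedPlusExpect_eq_of_symmDiff_eq`). No convergence hypothesis is needed: the two box
  sequences agree as soon as `B ⊆ box d L` (finite-volume change of variables `σ ↦ σ^B`,
  `isingExpect_fixed_eq_comp_flipOn`, any countable graph, any fixed boundary condition, any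
  field), hence have the same `limUnder`;
* **boundedness**: `|⟨f w⟩_Λ| ≤ C ⟨w⟩_Λ` in finite volume for `|f| ≤ C` and `w > 0`
  (`abs_isingExpect_mul_le`), and `|twistedPlusExpect d β h S f| ≤ C` whenever the two box
  sequences converge (`abs_twistedPlusExpect_le`; without convergence `limUnder` is junk);
* **existence for spin products** (`β, h ≥ 0`): `w_S` is a finite combination of spin products
  (`e^{-2βσ_b} = cosh 2β (1 - tanh 2β σ_b)`, the tree's `expNegBonds_eq_sum`), so by the existence
  of the plus state on spin products (`hasBoxLimit_isingCorr_plus_holds`) the box sequences of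
  `⟨σ_A w_S⟩⁺` and `⟨w_S⟩⁺` converge (`tendsto_isingExpect_plus_spinProduct_mul_disorderWeight`),
  `⟨w_S⟩⁺_{β,h} ≥ e^{-2|β||S|} > 0` (`plusExpect_disorderWeight_pos`), `⟨1⟩_S = 1` and
  `|⟨σ_A⟩_S| ≤ 1` (`abs_twistedPlusExpect_spinProduct_le_one`): the weight-free ratios of the
  route are genuine limits;
* the finite Boltzmann-sum formula for `∫ f dμ_{Λ;β,h}^{bc}` WITHOUT measurability of `f` on a
  countable vertex set (`integral_isingMeasure_of_countable`), used throughout.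

## Design

The directed representation `Site d × Fin d` is the requester's (route items sum over explicit
bond lists); `latticeBond` and `sum_edgeBoundary_eq_sum_bondCoboundary` bridge to the tree's
`Sym2`-valued edge sets (`edgeBoundary`). The gauge lemma is stated at `h = 0` (with a field the
flip also produces `exp(-2βh ∑_{t ∈ B} σ_t)`; the finite-volume lemma keeps `h`). Mathlib has no
Ising model; tree anchors: `plusExpect`, `isingExpect`, `flipOn`, `flipOnFin`, `glue_flipOnFin`,
`isingHamiltonian_sub_isingHamiltonian_flipOn`, `edgeBoundary`, `eventually_subset_box_holds`,
`exp_mul_eq_cosh_add_sinh_mul`, `expNegBonds_eq_sum`, `bondsSupport`,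
`hasBoxLimit_isingCorr_plus_holds`. Not here: the random-current (linking-parity) representation
of `⟨σ_A w_S⟩` (route item `LinkingParityRepresentation`), plaquette discretisations of round
discs, and anything at `β = β_c` specifically.

## References

* L. P. Kadanoff, H. Ceva, *Determination of an operator algebra for the two-dimensional Ising
  model*, Phys. Rev. B 3 (1971) 3918–3939, §II.A [KadanoffCeva1971].
* F. J. Wegner, *Duality in generalized Ising models and phase transitions without local order
  parameters*, J. Math. Phys. 12 (1971) 2259–2272 [Wegner1971].
* M. Billó, M. Caselle, D. Gaiotto, F. Gliozzi, M. Meineri, R. Pellegrini, *Line defects in the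
  3d Ising model*, JHEP 07 (2013) 055, §3 [BilloEtAl2013].
* S. Friedli, Y. Velenik, *Statistical Mechanics of Lattice Systems* (CUP 2017), §3.1
  [FriedliVelenik2017].
-/

noncomputable section

open MeasureTheory Filter Topology Finset
open scoped symmDiff

namespace Literature.Probability.LatticeModels

/-! ### Finite-volume Gibbs averages on a countable graph: all observables, change of variables -/

section General

variable {V : Type*} [DecidableEq V] (G : SimpleGraph V) [G.LocallyFinite]

/-- On a countable vertex set every observable `f` (measurable or not) is integrated by the
finite Boltzmann sum: `∫ f dμ_{Λ;β,h}^{bc} = (∑_τ w(τ) f(glue τ)) / Z` — the gluing map is a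
measurable embedding of the finite discrete space `Λ → ℤˣ` (singletons of `V → ℤˣ` are measurable
for countable `V`), so `Measure.map` needs no measurability of the integrand
(Friedli–Velenik 2017, §3.1, eq. (3.8)). [cite: FriedliVelenik2017, §3.1 eq. (3.8)] -/
theorem integral_isingMeasure_of_countable [Countable V] (Λ : Finset V) (β h : ℝ)
    (bc : BoundaryCondition V) (f : SpinConfig V → ℝ) :
    ∫ σ, f σ ∂isingMeasure G Λ β h bc =
      (∑ τ : Λ → ℤˣ, isingWeight G Λ β h bc τ * f (glue Λ τ bc)) /
        isingPartitionFunction G Λ β h bc := by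
  have hemb : MeasurableEmbedding (fun τ : Λ → ℤˣ => glue Λ τ bc) :=
    { injective := glue_injective Λ bc
      measurable := measurable_glue Λ bc
      measurableSet_image' := fun s _ => (s.to_countable.image _).measurableSet }
  rw [isingMeasure, integral_tilted, integral_exp_isingRef, isingRef, hemb.integral_map,
    integral_fintype Integrable.of_finite, Finset.sum_div]
  refine Finset.sum_congr rfl fun τ _ => ?_
  simp only [count_real_singleton, smul_eq_mul, isingWeight]
  ring

/-- `⟨f⟩_{Λ;β,h}^{bc}` as a finite Boltzmann sum, for every observable on a countable graph
(Friedli–Velenik 2017, §3.1, eq. (3.8)). [cite: FriedliVelenik2017, §3.1 eq. (3.8)] -/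
theorem isingExpect_eq_sum_div_of_countable [Countable V] (Λ : Finset V) (β h : ℝ)
    (bc : BoundaryCondition V) (f : SpinConfig V → ℝ) :
    isingExpect G Λ β h bc f =
      (∑ τ : Λ → ℤˣ, isingWeight G Λ β h bc τ * f (glue Λ τ bc)) /
        isingPartitionFunction G Λ β h bc :=
  integral_isingMeasure_of_countable G Λ β h bc f

/-- **Change of variables `σ ↦ σ^B` (flip of the spins on `B ⊆ Λ`) in a fixed-boundary-condition
Gibbs average**: `⟨g⟩^η_{Λ;β,h} = ⟨(g ∘ flipOn B) · exp(-2β ∑_{e ∈ δB} σ_e - 2βh ∑_{t ∈ B} σ_t)⟩^η_{Λ;β,h}`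
— flipping the summation variables on `B` flips the couplings on the coboundary `δB`
(and the field on `B`) (Kadanoff–Ceva 1971, §II.A, the argument after eq. (2.3); energy
bookkeeping `isingHamiltonian_sub_isingHamiltonian_flipOn`, Friedli–Velenik 2017, Lemma 3.36).
[cite: KadanoffCeva1971, §II.A, after eq. (2.3)] -/
theorem isingExpect_fixed_eq_comp_flipOn [Countable V] {Λ B : Finset V} (hB : B ⊆ Λ) (β h : ℝ)
    (η : SpinConfig V) (g : SpinConfig V → ℝ) :
    isingExpect G Λ β h (.fixed η) g =
      isingExpect G Λ β h (.fixed η) (fun σ => g (flipOn B σ) *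
        Real.exp (-2 * β * ∑ e ∈ edgeBoundary G B, bondSpin σ e
          - 2 * β * h * ∑ t ∈ B, spinAt t σ)) := by
  rw [isingExpect_eq_sum_div_of_countable, isingExpect_eq_sum_div_of_countable]
  congr 1
  have hinv : Function.Involutive (flipOnFin Λ B) := flipOnFin_flipOnFin Λ B
  symm
  refine Fintype.sum_equiv (hinv.toPerm _) _ _ fun τ => ?_
  rw [Function.Involutive.coe_toPerm, isingWeight, isingWeight, glue_flipOnFin hB η τ]
  have hD := isingHamiltonian_sub_isingHamiltonian_flipOn G hB h η (glue Λ τ (.fixed η))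
  have hexp : -β * isingHamiltonian G Λ h (.fixed η) (flipOn B (glue Λ τ (.fixed η))) =
      -β * isingHamiltonian G Λ h (.fixed η) (glue Λ τ (.fixed η)) +
        (-2 * β * ∑ e ∈ edgeBoundary G B, bondSpin (glue Λ τ (.fixed η)) e
          - 2 * β * h * ∑ t ∈ B, spinAt t (glue Λ τ (.fixed η))) := by
    linear_combination β * hD
  rw [hexp, Real.exp_add]
  ring

/-- The expectation of a pointwise positive observable is positive (any observable, countable
graph). [folklore] -/
theorem isingExpect_pos_of_countable [Countable V] (Λ : Finset V) (β h : ℝ)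
    (bc : BoundaryCondition V) {w : SpinConfig V → ℝ} (hw : ∀ σ, 0 < w σ) :
    0 < isingExpect G Λ β h bc w := by
  rw [isingExpect_eq_sum_div_of_countable]
  exact div_pos (Finset.sum_pos (fun τ _ => mul_pos (isingWeight_pos G Λ β h bc τ) (hw _))
    Finset.univ_nonempty) (isingPartitionFunction_pos G Λ β h bc)

/-- **Boundedness of tilted averages** in finite volume: if `|f| ≤ C` and `w > 0` pointwise then
`|⟨f w⟩| ≤ C ⟨w⟩` (positivity of the tilted measure `w dμ`; any observables, countable graph).
[folklore] -/
theorem abs_isingExpect_mul_le [Countable V] (Λ : Finset V) (β h : ℝ) (bc : BoundaryCondition V)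
    {f w : SpinConfig V → ℝ} {C : ℝ} (hf : ∀ σ, |f σ| ≤ C) (hw : ∀ σ, 0 < w σ) :
    |isingExpect G Λ β h bc (fun σ => f σ * w σ)| ≤ C * isingExpect G Λ β h bc w := by
  rw [isingExpect_eq_sum_div_of_countable, isingExpect_eq_sum_div_of_countable, abs_div,
    abs_of_pos (isingPartitionFunction_pos G Λ β h bc), ← mul_div_assoc]
  refine div_le_div_of_nonneg_right ?_ (isingPartitionFunction_pos G Λ β h bc).le
  calc |∑ τ : Λ → ℤˣ, isingWeight G Λ β h bc τ * (f (glue Λ τ bc) * w (glue Λ τ bc))|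
      ≤ ∑ τ : Λ → ℤˣ, |isingWeight G Λ β h bc τ * (f (glue Λ τ bc) * w (glue Λ τ bc))| :=
        Finset.abs_sum_le_sum_abs _ _
    _ ≤ ∑ τ : Λ → ℤˣ, C * (isingWeight G Λ β h bc τ * w (glue Λ τ bc)) :=
        Finset.sum_le_sum fun τ _ => by
          rw [abs_mul, abs_mul, abs_of_pos (isingWeight_pos G Λ β h bc τ), abs_of_pos (hw _)]
          calc isingWeight G Λ β h bc τ * (|f (glue Λ τ bc)| * w (glue Λ τ bc))
              ≤ isingWeight G Λ β h bc τ * (C * w (glue Λ τ bc)) :=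
                mul_le_mul_of_nonneg_left (mul_le_mul_of_nonneg_right (hf _) (hw _).le)
                  (isingWeight_pos G Λ β h bc τ).le
            _ = C * (isingWeight G Λ β h bc τ * w (glue Λ τ bc)) := by ring
    _ = C * ∑ τ : Λ → ℤˣ, isingWeight G Λ β h bc τ * w (glue Λ τ bc) := by rw [Finset.mul_sum]

/-- The ratio form: `|⟨f w⟩ / ⟨w⟩| ≤ C` for `|f| ≤ C`, `w > 0` (finite volume, countable graph).
[folklore] -/
theorem abs_isingExpect_mul_div_le [Countable V] (Λ : Finset V) (β h : ℝ)
    (bc : BoundaryCondition V) {f w : SpinConfig V → ℝ} {C : ℝ} (hf : ∀ σ, |f σ| ≤ C)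
    (hw : ∀ σ, 0 < w σ) :
    |isingExpect G Λ β h bc (fun σ => f σ * w σ) / isingExpect G Λ β h bc w| ≤ C := by
  have hpos := isingExpect_pos_of_countable G Λ β h bc hw
  rw [abs_div, abs_of_pos hpos, div_le_iff₀ hpos]
  exact abs_isingExpect_mul_le G Λ β h bc hf hw

end General

/-! ### Directed lattice bonds of `ℤ^d` and the bond coboundary of a finite set -/

variable {d : ℕ}

/-- The nearest-neighbour bond of `ℤ^d` encoded by the pair `(a, i)`: the unordered pair
`{a, a + eᵢ}`; every edge of `zdGraph d` has exactly one such code (`latticeBond_injective`,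
`exists_latticeBond_eq_of_mem_edgeSet`) (Friedli–Velenik 2017, §3.1). [cite: FriedliVelenik2017, §3.1] -/
def latticeBond (b : Site d × Fin d) : Sym2 (Site d) :=
  s(b.1, b.1 + Pi.single b.2 1)

/-- `latticeBond (a, i) = s(a, a + eᵢ)`. [folklore] -/
@[simp] theorem latticeBond_mk (a : Site d) (i : Fin d) :
    latticeBond (a, i) = s(a, a + Pi.single i 1) := rfl

/-- The bond observable of a directed bond is `σ_a σ_{a+eᵢ}`. [folklore] -/
@[simp] theorem bondSpin_latticeBond (σ : SpinConfig (Site d)) (b : Site d × Fin d) :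
    bondSpin σ (latticeBond b) = spinAt b.1 σ * spinAt (b.1 + Pi.single b.2 1) σ := rfl

/-- Two unit coordinate vectors of `ℤ^d` never add up to `0`. [folklore] -/
theorem single_add_single_ne_zero (i j : Fin d) :
    (Pi.single i 1 : Site d) + Pi.single j 1 ≠ 0 := by
  intro h
  have hi := congr_fun h i
  simp only [Pi.add_apply, Pi.single_eq_same, Pi.zero_apply] at hi
  by_cases hij : i = j
  · subst hij
    simp at hi
  · rw [Pi.single_eq_of_ne hij, add_zero] at hi
    exact one_ne_zero hi

/-- The code `(a, i) ↦ {a, a + eᵢ}` is injective. [folklore] -/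
theorem latticeBond_injective : Function.Injective (latticeBond (d := d)) := by
  rintro ⟨a, i⟩ ⟨a', j⟩ h
  simp only [latticeBond_mk, Sym2.eq_iff] at h
  rcases h with ⟨rfl, h⟩ | ⟨h₁, h₂⟩
  · have hij : (Pi.single i (1 : ℤ) : Site d) = Pi.single j 1 := add_left_cancel h
    have hi := congr_fun hij i
    simp only [Pi.single_eq_same] at hi
    by_cases h' : i = j
    · subst h'; rfl
    · rw [Pi.single_eq_of_ne h'] at hi
      exact absurd hi one_ne_zero
  · exfalso
    apply single_add_single_ne_zero (d := d) j i
    have : a' + (Pi.single j 1 + Pi.single i 1) = a' + 0 := by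
      rw [← add_assoc, ← h₁, h₂, add_zero]
    exact add_left_cancel this

/-- Every coded pair is an edge of `ℤ^d`. [folklore] -/
theorem latticeBond_mem_edgeSet (b : Site d × Fin d) : latticeBond b ∈ (zdGraph d).edgeSet := by
  rw [latticeBond, SimpleGraph.mem_edgeSet, zdGraph_adj_iff]
  exact ⟨b.2, Or.inl rfl⟩

/-- Every edge of `ℤ^d` is coded by some pair `(a, i)`. [folklore] -/
theorem exists_latticeBond_eq_of_mem_edgeSet {e : Sym2 (Site d)} (he : e ∈ (zdGraph d).edgeSet) :
    ∃ b : Site d × Fin d, latticeBond b = e := by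
  induction e using Sym2.ind with
  | _ x y =>
    rw [SimpleGraph.mem_edgeSet, zdGraph_adj_iff] at he
    obtain ⟨i, h | h⟩ := he
    · exact ⟨(x, i), by rw [latticeBond_mk, ← h]⟩
    · exact ⟨(y, i), by rw [latticeBond_mk, ← h, Sym2.eq_swap]⟩

/-- The **bond coboundary** `δB` of a finite set of sites: the directed bonds `(a, i)` with exactly
one of `a`, `a + eᵢ` in `B` (the bonds whose coupling is flipped by the change of variables
`σ ↦ σ^B`; Kadanoff–Ceva 1971, §II.A, Fig. 1(c)). [cite: KadanoffCeva1971, §II.A, Fig. 1(c)] -/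
def bondCoboundary (B : Finset (Site d)) : Finset (Site d × Fin d) :=
  ((B ×ˢ Finset.univ) ∪ (B ×ˢ Finset.univ).image fun b => (b.1 - Pi.single b.2 1, b.2)).filter
    fun b => Xor (b.1 ∈ B) (b.1 + Pi.single b.2 1 ∈ B)

/-- Membership in the bond coboundary: exactly one endpoint lies in `B`. [folklore] -/
theorem mem_bondCoboundary_iff {B : Finset (Site d)} {b : Site d × Fin d} :
    b ∈ bondCoboundary B ↔ Xor (b.1 ∈ B) (b.1 + Pi.single b.2 1 ∈ B) := by
  rw [bondCoboundary, Finset.mem_filter, and_iff_right_iff_imp]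
  intro h
  rw [Finset.mem_union, Finset.mem_product, Finset.mem_image]
  rcases h with ⟨h1, -⟩ | ⟨h2, -⟩
  · exact Or.inl ⟨h1, Finset.mem_univ _⟩
  · refine Or.inr ⟨(b.1 + Pi.single b.2 1, b.2), Finset.mem_product.2 ⟨h2, Finset.mem_univ _⟩, ?_⟩
    simp

/-- The coded coboundary is the edge boundary of the tree (`edgeBoundary`): `latticeBond` maps
`bondCoboundary B` bijectively onto `edgeBoundary (zdGraph d) B`. [folklore] -/
theorem image_latticeBond_bondCoboundary (B : Finset (Site d)) :
    (bondCoboundary B).image latticeBond = edgeBoundary (zdGraph d) B := by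
  ext e
  simp only [Finset.mem_image, mem_edgeBoundary_iff]
  constructor
  · rintro ⟨b, hb, rfl⟩
    rw [mem_bondCoboundary_iff] at hb
    refine ⟨latticeBond_mem_edgeSet b, ?_, ?_⟩
    · rcases hb with ⟨h1, -⟩ | ⟨h2, -⟩
      · exact ⟨b.1, h1, by simp [latticeBond]⟩
      · exact ⟨b.1 + Pi.single b.2 1, h2, by simp [latticeBond]⟩
    · rcases hb with ⟨-, h2⟩ | ⟨-, h1⟩
      · exact ⟨b.1 + Pi.single b.2 1, h2, by simp [latticeBond]⟩
      · exact ⟨b.1, h1, by simp [latticeBond]⟩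
  · rintro ⟨he, ⟨x, hxB, hxe⟩, ⟨y, hyB, hye⟩⟩
    obtain ⟨b, rfl⟩ := exists_latticeBond_eq_of_mem_edgeSet he
    refine ⟨b, mem_bondCoboundary_iff.2 ?_, rfl⟩
    simp only [latticeBond, Sym2.mem_iff] at hxe hye
    rcases hxe with rfl | rfl <;> rcases hye with rfl | rfl
    · exact absurd hxB hyB
    · exact Or.inl ⟨hxB, hyB⟩
    · exact Or.inr ⟨hxB, hyB⟩
    · exact absurd hxB hyB

/-- Sums over the edge boundary of `B` in `ℤ^d` are sums over the coded coboundary. [folklore] -/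
theorem sum_edgeBoundary_eq_sum_bondCoboundary (B : Finset (Site d)) (g : Sym2 (Site d) → ℝ) :
    ∑ e ∈ edgeBoundary (zdGraph d) B, g e = ∑ b ∈ bondCoboundary B, g (latticeBond b) := by
  rw [← image_latticeBond_bondCoboundary, Finset.sum_image fun x _ y _ h => latticeBond_injective h]

/-! ### The disorder weight and the twisted plus state

Maintenance note (build repair 2026-08-20, statements unchanged): the lattice disorder weight
`disorderWeight` and its three elementary lemmas `disorderWeight_pos`,
`measurable_disorderWeight`, `disorderWeight_empty` live in the sub-namespace
`Literature.Probability.LatticeModels.Twisted`, because the graph-level disorder insertion of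
`IsingDisorderFermion.lean` (signature `(β : ℝ) (T : Finset (Sym2 V))`, Chelkak–Hongler–Izyurov)
declares the same four names directly in `Literature.Probability.LatticeModels`, and both files
are imported together by the `Literature` root module and by the CriticalPhenomena tribunal
aggregate ("environment already contains `…LatticeModels.disorderWeight`"). The `open` right
after `end Twisted` keeps every other statement of this file textually as it was accepted. -/

namespace Twisted

/-- **The disorder (twist) weight** of a finite set `S` of directed bonds of `ℤ^d`:
`w_S(σ) = exp (-2β ∑_{(a,i) ∈ S} σ_a σ_{a+eᵢ}) = ∏_{b ∈ S} e^{-2β σ_b}`, the factor that flips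
the couplings on `S` (`K ↦ -K` on the path/surface: Kadanoff–Ceva 1971, §II.A, eq. (2.2);
Billó et al. 2013, §3, `J_b = -1` on the bonds crossing the surface). [cite: KadanoffCeva1971, §II.A eq. (2.2)] -/
def disorderWeight (S : Finset (Site d × Fin d)) (β : ℝ) (σ : SpinConfig (Site d)) : ℝ :=
  Real.exp (-2 * β * ∑ b ∈ S, spinAt b.1 σ * spinAt (b.1 + Pi.single b.2 1) σ)

/-- The disorder weight `w_S = exp (-2β ∑_{b ∈ S} σ_b)` of Kadanoff–Ceva's eq. (2.2) is positive
(it is an exponential). [cite: KadanoffCeva1971, §II.A eq. (2.2)] -/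
theorem disorderWeight_pos (S : Finset (Site d × Fin d)) (β : ℝ) (σ : SpinConfig (Site d)) :
    0 < disorderWeight S β σ :=
  Real.exp_pos _

/-- The disorder weight `w_S` of Kadanoff–Ceva's eq. (2.2) is a measurable function of the spin
configuration (product σ-algebra; a finite sum of products of coordinate spins under `exp`).
[cite: KadanoffCeva1971, §II.A eq. (2.2)] -/
@[fun_prop]
theorem measurable_disorderWeight (S : Finset (Site d × Fin d)) (β : ℝ) :
    Measurable (disorderWeight S β) := by
  unfold disorderWeight
  exact Real.measurable_exp.comp ((Finset.measurable_sum _ fun b _ =>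
    (measurable_spinAt b.1).mul (measurable_spinAt _)).const_mul _)

/-- No flipped bond: `w_∅ = 1` (the empty sum in Kadanoff–Ceva's eq. (2.2)).
[cite: KadanoffCeva1971, §II.A eq. (2.2)] -/
@[simp] theorem disorderWeight_empty (β : ℝ) (σ : SpinConfig (Site d)) :
    disorderWeight ∅ β σ = 1 := by
  simp [disorderWeight]

end Twisted

open Literature.Probability.LatticeModels.Twisted

variable (d) in
/-- **The twisted plus state** (disorder / twist insertion in the plus state):
`⟨f⟩_S := ⟨f · w_S⟩⁺_{β,h} / ⟨w_S⟩⁺_{β,h}`, the expectation of `f` in the plus state of the Ising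
model on `ℤ^d` with the couplings on the bonds of `S` flipped, written as a ratio of two
plus-state expectations (`plusExpect`, limits along boxes; junk-valued exactly when those are,
genuine limits for spin products and `β, h ≥ 0`, see `plusExpect_disorderWeight_pos`). The
normalisation `⟨w_S⟩⁺ = Z{K̃}/Z{K}` is, for `d = 2` and `S` the bonds crossed by a dual path from
`r₁` to `r₂`, Kadanoff–Ceva's disorder correlation `⟨μ_{r₁} μ_{r₂}⟩` (1971, §II.A, eq. (2.3)), so
that `⟨σ_A⟩_S = ⟨σ_A μ_{r₁} μ_{r₂}⟩ / ⟨μ_{r₁} μ_{r₂}⟩` is the normalised mixed order–disorder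
correlation; for `d = 3` and `S` the bonds crossing a surface with boundary `L`, `⟨·⟩_S` is the
expectation in the presence of the twist line defect `L` (Billó et al. 2013, §3).
[cite: KadanoffCeva1971, §II.A eq. (2.3)] -/
def twistedPlusExpect (β h : ℝ) (S : Finset (Site d × Fin d)) (f : SpinConfig (Site d) → ℝ) : ℝ :=
  plusExpect d β h (fun σ => f σ * disorderWeight S β σ) / plusExpect d β h (disorderWeight S β)

/-- Unfolding lemma for `twistedPlusExpect`. [folklore] -/
theorem twistedPlusExpect_def (β h : ℝ) (S : Finset (Site d × Fin d))
    (f : SpinConfig (Site d) → ℝ) :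
    twistedPlusExpect d β h S f =
      plusExpect d β h (fun σ => f σ * disorderWeight S β σ) /
        plusExpect d β h (disorderWeight S β) := rfl

/-- The disorder weight as `expNegBonds`-style exponential over the coded `Sym2` bonds:
`w_S(σ) = exp (-(2β) ∑_{b ∈ S} σ_{latticeBond b})`. [folklore] -/
theorem disorderWeight_eq_exp_sum_bondSpin (S : Finset (Site d × Fin d)) (β : ℝ)
    (σ : SpinConfig (Site d)) :
    disorderWeight S β σ = Real.exp (-(2 * β) * ∑ b ∈ S, bondSpin σ (latticeBond b)) := by
  simp only [disorderWeight, bondSpin_latticeBond, neg_mul]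

/-- `e^{-2βs} = cosh 2β - sinh 2β · s` for `s = ±1`. [folklore] -/
theorem exp_neg_two_mul_mul_eq {s : ℝ} (hs : s * s = 1) (β : ℝ) :
    Real.exp (-2 * β * s) = Real.cosh (2 * β) - Real.sinh (2 * β) * s := by
  rw [show -2 * β * s = (-(2 * β)) * s by ring, exp_mul_eq_cosh_add_sinh_mul hs,
    Real.cosh_neg, Real.sinh_neg]
  ring

/-- `σ_b σ_b = 1` for a directed bond. [folklore] -/
theorem bond_mul_self (b : Site d × Fin d) (σ : SpinConfig (Site d)) :
    spinAt b.1 σ * spinAt (b.1 + Pi.single b.2 1) σ *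
      (spinAt b.1 σ * spinAt (b.1 + Pi.single b.2 1) σ) = 1 := by
  rw [mul_mul_mul_comm, spinAt_mul_self, spinAt_mul_self, mul_one]

/-- **The elementary loop** (a single flipped bond; in `d = 3` the disorder loop around one dual
plaquette): `w_{{b}} = cosh 2β - sinh 2β · σ_b` — the energy operator. [folklore] -/
theorem disorderWeight_singleton (b : Site d × Fin d) (β : ℝ) (σ : SpinConfig (Site d)) :
    disorderWeight {b} β σ =
      Real.cosh (2 * β) - Real.sinh (2 * β) * (spinAt b.1 σ * spinAt (b.1 + Pi.single b.2 1) σ) := by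
  rw [disorderWeight, Finset.sum_singleton, exp_neg_two_mul_mul_eq (bond_mul_self b σ)]

/-- Product form: `w_S = ∏_{b ∈ S} (cosh 2β - sinh 2β · σ_b)`. [folklore] -/
theorem disorderWeight_eq_prod (S : Finset (Site d × Fin d)) (β : ℝ) (σ : SpinConfig (Site d)) :
    disorderWeight S β σ =
      ∏ b ∈ S, (Real.cosh (2 * β) -
        Real.sinh (2 * β) * (spinAt b.1 σ * spinAt (b.1 + Pi.single b.2 1) σ)) := by
  rw [disorderWeight, Finset.mul_sum, Real.exp_sum]
  exact Finset.prod_congr rfl fun b _ => exp_neg_two_mul_mul_eq (bond_mul_self b σ) β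

/-- Disjoint bond sets: `w_{S ∪ T} = w_S · w_T`. [folklore] -/
theorem disorderWeight_union {S T : Finset (Site d × Fin d)} (hST : Disjoint S T) (β : ℝ)
    (σ : SpinConfig (Site d)) :
    disorderWeight (S ∪ T) β σ = disorderWeight S β σ * disorderWeight T β σ := by
  rw [disorderWeight, disorderWeight, disorderWeight, Finset.sum_union hST, mul_add, Real.exp_add]

/-- The plus state of the constant `1` is `1` (the box sequence is constant). [folklore] -/
theorem plusExpect_one (β h : ℝ) : plusExpect d β h (fun _ => (1 : ℝ)) = 1 := by
  simp only [plusExpect, isingExpect_const]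
  exact tendsto_const_nhds.limUnder_eq

/-- No flipped bond: `⟨f⟩_∅ = ⟨f⟩⁺`. [folklore] -/
@[simp] theorem twistedPlusExpect_empty (β h : ℝ) (f : SpinConfig (Site d) → ℝ) :
    twistedPlusExpect d β h ∅ f = plusExpect d β h f := by
  have h1 : (fun σ => f σ * disorderWeight ∅ β σ) = f := funext fun σ => by simp
  have h2 : disorderWeight (d := d) ∅ β = fun _ => 1 := funext fun σ => by simp
  rw [twistedPlusExpect, h1, h2, plusExpect_one, div_one]

/-! ### Gauge invariance (surface independence) -/

/-- A directed bond picks up the sign `-1` under the flip on `B` iff it lies in `δB`.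
[cite: KadanoffCeva1971, §II.A, after eq. (2.3)] -/
theorem bond_flipOn (B : Finset (Site d)) (b : Site d × Fin d) (σ : SpinConfig (Site d)) :
    spinAt b.1 (flipOn B σ) * spinAt (b.1 + Pi.single b.2 1) (flipOn B σ) =
      (if b ∈ bondCoboundary B then -1 else 1) *
        (spinAt b.1 σ * spinAt (b.1 + Pi.single b.2 1) σ) := by
  rw [spinAt_flipOn, spinAt_flipOn]
  by_cases h1 : b.1 ∈ B <;> by_cases h2 : b.1 + Pi.single b.2 1 ∈ B <;>
    simp [mem_bondCoboundary_iff, Xor, h1, h2]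

/-- **Flipping `B` moves the disorder set by `δB`**:
`w_S(σ^B) · w_{δB}(σ) = w_{S ∆ δB}(σ)`. [cite: KadanoffCeva1971, §II.A, after eq. (2.3)] -/
theorem disorderWeight_flipOn_mul (S : Finset (Site d × Fin d)) (B : Finset (Site d)) (β : ℝ)
    (σ : SpinConfig (Site d)) :
    disorderWeight S β (flipOn B σ) * disorderWeight (bondCoboundary B) β σ =
      disorderWeight (S ∆ bondCoboundary B) β σ := by
  set D := bondCoboundary B with hD
  rw [disorderWeight, disorderWeight, disorderWeight, ← Real.exp_add, ← mul_add]
  congr 2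
  -- split `S = (S \ D) ∪ (S ∩ D)`, `D = (D \ S) ∪ (S ∩ D)`, `S ∆ D = (S \ D) ∪ (D \ S)`
  have hS : ∑ b ∈ S, spinAt b.1 (flipOn B σ) * spinAt (b.1 + Pi.single b.2 1) (flipOn B σ) =
      ∑ b ∈ S \ D, spinAt b.1 σ * spinAt (b.1 + Pi.single b.2 1) σ -
        ∑ b ∈ S ∩ D, spinAt b.1 σ * spinAt (b.1 + Pi.single b.2 1) σ := by
    rw [← Finset.sum_sdiff (Finset.inter_subset_left (s₁ := S) (s₂ := D)),
      Finset.sdiff_inter_self_left, sub_eq_add_neg, ← Finset.sum_neg_distrib]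
    congr 1
    · refine Finset.sum_congr rfl fun b hb => ?_
      rw [bond_flipOn, if_neg (Finset.mem_sdiff.1 hb).2, one_mul]
    · refine Finset.sum_congr rfl fun b hb => ?_
      rw [bond_flipOn, if_pos (Finset.mem_inter.1 hb).2, neg_one_mul]
  have hDsum : ∑ b ∈ D, spinAt b.1 σ * spinAt (b.1 + Pi.single b.2 1) σ =
      ∑ b ∈ D \ S, spinAt b.1 σ * spinAt (b.1 + Pi.single b.2 1) σ +
        ∑ b ∈ S ∩ D, spinAt b.1 σ * spinAt (b.1 + Pi.single b.2 1) σ := by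
    rw [Finset.inter_comm, ← Finset.sum_sdiff (Finset.inter_subset_left (s₁ := D) (s₂ := S)),
      Finset.sdiff_inter_self_left]
  rw [hS, hDsum, Finset.symmDiff_def, Finset.sum_union disjoint_sdiff_sdiff]
  ring

/-- **Gauge covariance in finite volume** (`ℤ^d`, fixed boundary condition `η`, zero field,
`B ⊆ Λ`): `⟨f · w_S⟩^η_Λ = ⟨(f ∘ flipOn B) · w_{S ∆ δB}⟩^η_Λ`.
[cite: KadanoffCeva1971, §II.A, after eq. (2.3)] -/
theorem isingExpect_mul_disorderWeight_eq_comp_flipOn {Λ B : Finset (Site d)} (hB : B ⊆ Λ)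
    (β : ℝ) (η : SpinConfig (Site d)) (S : Finset (Site d × Fin d))
    (f : SpinConfig (Site d) → ℝ) :
    isingExpect (zdGraph d) Λ β 0 (.fixed η) (fun σ => f σ * disorderWeight S β σ) =
      isingExpect (zdGraph d) Λ β 0 (.fixed η)
        (fun σ => f (flipOn B σ) * disorderWeight (S ∆ bondCoboundary B) β σ) := by
  rw [isingExpect_fixed_eq_comp_flipOn (zdGraph d) hB β 0 η]
  congr 1
  funext σ
  rw [mul_zero, zero_mul, sub_zero, sum_edgeBoundary_eq_sum_bondCoboundary, mul_assoc,
    ← disorderWeight_flipOn_mul S B β σ]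
  rfl

/-- **Gauge covariance of the un-normalised plus-state insertion** (zero field): for every finite
`B ⊆ ℤ^d`, `⟨f · w_S⟩⁺_β = ⟨(f ∘ flipOn B) · w_{S ∆ δB}⟩⁺_β`. No convergence hypothesis: the two
box sequences coincide as soon as `B ⊆ box d L`, so their `limUnder`s agree (junk or not).
[cite: KadanoffCeva1971, §II.A, after eq. (2.3)] -/
theorem plusExpect_mul_disorderWeight_eq_comp_flipOn (β : ℝ) (B : Finset (Site d))
    (S : Finset (Site d × Fin d)) (f : SpinConfig (Site d) → ℝ) :
    plusExpect d β 0 (fun σ => f σ * disorderWeight S β σ) =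
      plusExpect d β 0 (fun σ => f (flipOn B σ) * disorderWeight (S ∆ bondCoboundary B) β σ) := by
  have hev : (fun L : ℕ => isingExpect (zdGraph d) (box d L) β 0 .plus
      (fun σ => f σ * disorderWeight S β σ)) =ᶠ[atTop]
      (fun L : ℕ => isingExpect (zdGraph d) (box d L) β 0 .plus
        (fun σ => f (flipOn B σ) * disorderWeight (S ∆ bondCoboundary B) β σ)) := by
    filter_upwards [eventually_subset_box_holds (d := d) B] with L hL
    exact isingExpect_mul_disorderWeight_eq_comp_flipOn hL β 1 S f
  unfold plusExpect Filter.limUnder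
  rw [Filter.map_congr hev]

/-- The same for the normalisation: `⟨w_S⟩⁺_β = ⟨w_{S ∆ δB}⟩⁺_β`.
[cite: KadanoffCeva1971, §II.A, after eq. (2.3)] -/
theorem plusExpect_disorderWeight_eq_symmDiff (β : ℝ) (B : Finset (Site d))
    (S : Finset (Site d × Fin d)) :
    plusExpect d β 0 (disorderWeight S β) =
      plusExpect d β 0 (disorderWeight (S ∆ bondCoboundary B) β) := by
  simpa using plusExpect_mul_disorderWeight_eq_comp_flipOn β B S fun _ => 1

/-- **Gauge invariance of the twisted plus state** (surface / path independence up to the spin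
flip inside): for every finite `B ⊆ ℤ^d` and zero field,
`⟨f⟩_S = ⟨f ∘ flipOn B⟩_{S ∆ δB}` (Kadanoff–Ceva 1971, §II.A: "the result is independent of the
path"; Billó et al. 2013, §3: deforming the surface `S` to `S'` = flipping the spins in between).
[cite: KadanoffCeva1971, §II.A, after eq. (2.3)] -/
theorem twistedPlusExpect_eq_comp_flipOn (β : ℝ) (B : Finset (Site d))
    (S : Finset (Site d × Fin d)) (f : SpinConfig (Site d) → ℝ) :
    twistedPlusExpect d β 0 S f =
      twistedPlusExpect d β 0 (S ∆ bondCoboundary B) (f ∘ flipOn B) := by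
  rw [twistedPlusExpect, twistedPlusExpect, plusExpect_mul_disorderWeight_eq_comp_flipOn β B S f,
    plusExpect_disorderWeight_eq_symmDiff β B S]
  rfl

/-- Hypothesis form of gauge invariance: if `S ∆ S'` is the coboundary of a finite `B`, then
`⟨f⟩_S = ⟨f ∘ flipOn B⟩_{S'}` (zero field). [cite: BilloEtAl2013, §3] -/
theorem twistedPlusExpect_eq_of_symmDiff_eq (β : ℝ) {B : Finset (Site d)}
    {S S' : Finset (Site d × Fin d)} (hSS' : S ∆ S' = bondCoboundary B)
    (f : SpinConfig (Site d) → ℝ) :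
    twistedPlusExpect d β 0 S f = twistedPlusExpect d β 0 S' (f ∘ flipOn B) := by
  rw [twistedPlusExpect_eq_comp_flipOn β B S f, ← hSS', symmDiff_symmDiff_cancel_left]

/-- In particular an observable supported off `B` is insensitive to the deformation:
`f ∘ flipOn B = f ⇒ ⟨f⟩_S = ⟨f⟩_{S'}`. [cite: BilloEtAl2013, §3] -/
theorem twistedPlusExpect_eq_of_symmDiff_eq_of_comp_flipOn_eq (β : ℝ) {B : Finset (Site d)}
    {S S' : Finset (Site d × Fin d)} (hSS' : S ∆ S' = bondCoboundary B)
    {f : SpinConfig (Site d) → ℝ} (hf : f ∘ flipOn B = f) :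
    twistedPlusExpect d β 0 S f = twistedPlusExpect d β 0 S' f := by
  rw [twistedPlusExpect_eq_of_symmDiff_eq β hSS' f, hf]

/-! ### Boundedness -/

/-- **Boundedness of the twisted plus state**: if `|f| ≤ C` pointwise and the two box sequences
defining `⟨f w_S⟩⁺` and `⟨w_S⟩⁺` converge, then `|⟨f⟩_S| ≤ C` (finite volume:
`|⟨f w⟩_Λ| ≤ C ⟨w⟩_Λ` by positivity of `w_S`, then pass to the limit; if the limit of `⟨w_S⟩_Λ`
vanishes the ratio is the junk value `0`). [folklore] -/
theorem abs_twistedPlusExpect_le {β h C : ℝ} {S : Finset (Site d × Fin d)}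
    {f : SpinConfig (Site d) → ℝ} (hf : ∀ σ, |f σ| ≤ C)
    (hnum : ∃ a, Tendsto (fun L : ℕ => isingExpect (zdGraph d) (box d L) β h .plus
      (fun σ => f σ * disorderWeight S β σ)) atTop (𝓝 a))
    (hden : ∃ a, Tendsto (fun L : ℕ => isingExpect (zdGraph d) (box d L) β h .plus
      (disorderWeight S β)) atTop (𝓝 a)) :
    |twistedPlusExpect d β h S f| ≤ C := by
  obtain ⟨N, hN⟩ := hnum
  obtain ⟨D, hD⟩ := hden
  have hC : 0 ≤ C := (abs_nonneg _).trans (hf 1)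
  have hle : ∀ L : ℕ, |isingExpect (zdGraph d) (box d L) β h .plus
      (fun σ => f σ * disorderWeight S β σ)| ≤
        C * isingExpect (zdGraph d) (box d L) β h .plus (disorderWeight S β) := fun L =>
    abs_isingExpect_mul_le (zdGraph d) (box d L) β h .plus hf (disorderWeight_pos S β)
  have hlim : |N| ≤ C * D :=
    le_of_tendsto_of_tendsto' ((continuous_abs.tendsto N).comp hN) (hD.const_mul C) hle
  have hD0 : 0 ≤ D :=
    ge_of_tendsto' hD fun L =>
      (isingExpect_pos_of_countable (zdGraph d) (box d L) β h .plus (disorderWeight_pos S β)).le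
  rw [twistedPlusExpect, plusExpect, plusExpect, hN.limUnder_eq, hD.limUnder_eq]
  rcases hD0.eq_or_lt with h0 | hpos
  · rw [← h0, div_zero, abs_zero]
    exact hC
  · rw [abs_div, abs_of_pos hpos, div_le_iff₀ hpos]
    exact hlim

/-! ### Existence of the limits for spin-product observables (`β, h ≥ 0`) -/

/-- The coded bonds have distinct endpoints. [folklore] -/
theorem not_isDiag_latticeBond (b : Site d × Fin d) : ¬(latticeBond b).IsDiag :=
  not_isDiag_of_mem_edgeSet d (latticeBond_mem_edgeSet b)

/-- Bridge to the tree's `expNegBonds` (ADS15 (2.14) Boltzmann factor):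
`w_S = e^{-(2β) K_T}` with `T = latticeBond '' S`. [folklore] -/
theorem disorderWeight_eq_expNegBonds (S : Finset (Site d × Fin d)) (β : ℝ)
    (σ : SpinConfig (Site d)) :
    disorderWeight S β σ = expNegBonds d (2 * β) (S.image latticeBond) σ := by
  rw [expNegBonds, Finset.sum_image fun x _ y _ h => latticeBond_injective h, disorderWeight]
  simp only [bondSpin_latticeBond, neg_mul]

/-- **`σ_A · w_S` is a finite combination of spin products**:
`σ_A w_S = ∑_{T ⊆ latticeBond '' S} cosh(2β)^{|S|} (-sinh 2β)^{|T|} / cosh(2β)^{|T|} · σ_{A ∆ A(T)}`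
(`e^{-2βσ_b} = cosh 2β - sinh 2β σ_b`, expand the product, `σ_A σ_B = σ_{A ∆ B}`).
[cite: AizenmanDuminilCopinSidoraviciusCMP2015, §2.2, eq. (2.14)] -/
theorem spinProduct_mul_disorderWeight_eq_sum (A : Finset (Site d)) (S : Finset (Site d × Fin d))
    (β : ℝ) (σ : SpinConfig (Site d)) :
    spinProduct A σ * disorderWeight S β σ = ∑ T ∈ (S.image latticeBond).powerset,
      Real.cosh (2 * β) ^ #(S.image latticeBond) * (-Real.sinh (2 * β)) ^ #T /
        Real.cosh (2 * β) ^ #T * spinProduct (A ∆ bondsSupport d T) σ := by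
  have hT : ∀ e ∈ S.image latticeBond, ¬e.IsDiag := fun e he => by
    obtain ⟨b, -, rfl⟩ := Finset.mem_image.1 he
    exact not_isDiag_latticeBond b
  rw [disorderWeight_eq_expNegBonds, expNegBonds_eq_sum d (2 * β) hT σ, Finset.mul_sum]
  refine Finset.sum_congr rfl fun T _ => ?_
  rw [← spinProduct_mul_spinProduct]
  ring

/-- The finite-volume expectation `⟨σ_A w_S⟩_{Λ;β,h}^{bc}` as the corresponding combination of
correlations. [cite: AizenmanDuminilCopinSidoraviciusCMP2015, §2.2, eq. (2.14)] -/
theorem isingExpect_spinProduct_mul_disorderWeight_eq_sum (Λ : Finset (Site d)) (β h : ℝ)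
    (bc : BoundaryCondition (Site d)) (A : Finset (Site d)) (S : Finset (Site d × Fin d)) :
    isingExpect (zdGraph d) Λ β h bc (fun σ => spinProduct A σ * disorderWeight S β σ) =
      ∑ T ∈ (S.image latticeBond).powerset,
        Real.cosh (2 * β) ^ #(S.image latticeBond) * (-Real.sinh (2 * β)) ^ #T /
          Real.cosh (2 * β) ^ #T * isingCorr (zdGraph d) Λ β h bc (A ∆ bondsSupport d T) := by
  have hfun : (fun σ => spinProduct A σ * disorderWeight S β σ) = fun σ =>
      ∑ T ∈ (S.image latticeBond).powerset,
        Real.cosh (2 * β) ^ #(S.image latticeBond) * (-Real.sinh (2 * β)) ^ #T /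
          Real.cosh (2 * β) ^ #T * spinProduct (A ∆ bondsSupport d T) σ :=
    funext (spinProduct_mul_disorderWeight_eq_sum A S β)
  rw [hfun, isingExpect_finset_sum' _ _ _ _ β _ _ fun T => (measurable_spinProduct _).const_mul _]
  refine Finset.sum_congr rfl fun T _ => ?_
  rw [isingExpect_const_mul' _ _ _ _ β _ (measurable_spinProduct _)]
  rfl

/-- **Existence of `⟨σ_A w_S⟩⁺_{β,h}`** for `β, h ≥ 0`: the box sequence
`⟨σ_A w_S⟩_{Λ(L);β,h}^+` converges (to `plusExpect d β h (σ_A w_S)`), by the existence of the plus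
state on spin products (`hasBoxLimit_isingCorr_plus_holds`, Friedli–Velenik 2017, Thm. 3.17)
applied to each term of the expansion. [cite: FriedliVelenik2017, Thm. 3.17] -/
theorem tendsto_isingExpect_plus_spinProduct_mul_disorderWeight {β h : ℝ} (hβ : 0 ≤ β)
    (hh : 0 ≤ h) (A : Finset (Site d)) (S : Finset (Site d × Fin d)) :
    Tendsto (fun L : ℕ => isingExpect (zdGraph d) (box d L) β h .plus
      (fun σ => spinProduct A σ * disorderWeight S β σ)) atTop
      (𝓝 (plusExpect d β h fun σ => spinProduct A σ * disorderWeight S β σ)) := by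
  have hconv : Tendsto (fun L : ℕ => isingExpect (zdGraph d) (box d L) β h .plus
      (fun σ => spinProduct A σ * disorderWeight S β σ)) atTop
      (𝓝 (∑ T ∈ (S.image latticeBond).powerset,
        Real.cosh (2 * β) ^ #(S.image latticeBond) * (-Real.sinh (2 * β)) ^ #T /
          Real.cosh (2 * β) ^ #T * plusCorr d β h (A ∆ bondsSupport d T))) := by
    simp_rw [isingExpect_spinProduct_mul_disorderWeight_eq_sum]
    exact tendsto_finsetSum _ fun T _ =>
      (hasBoxLimit_isingCorr_plus_holds hβ hh (A ∆ bondsSupport d T)).const_mul _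
  exact tendsto_nhds_limUnder ⟨_, hconv⟩

/-- **Existence of the normalisation `⟨w_S⟩⁺_{β,h}`** for `β, h ≥ 0` (the case `A = ∅`).
[cite: FriedliVelenik2017, Thm. 3.17] -/
theorem tendsto_isingExpect_plus_disorderWeight {β h : ℝ} (hβ : 0 ≤ β) (hh : 0 ≤ h)
    (S : Finset (Site d × Fin d)) :
    Tendsto (fun L : ℕ => isingExpect (zdGraph d) (box d L) β h .plus (disorderWeight S β)) atTop
      (𝓝 (plusExpect d β h (disorderWeight S β))) := by
  have h1 : (fun σ => spinProduct ∅ σ * disorderWeight S β σ) = disorderWeight S β :=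
    funext fun σ => by simp
  simpa only [h1] using tendsto_isingExpect_plus_spinProduct_mul_disorderWeight hβ hh ∅ S

/-- The disorder weight is bounded below: `w_S ≥ e^{-2|β| |S|}` (`|σ_b| = 1`). [folklore] -/
theorem exp_neg_le_disorderWeight (S : Finset (Site d × Fin d)) (β : ℝ) (σ : SpinConfig (Site d)) :
    Real.exp (-(2 * |β| * #S)) ≤ disorderWeight S β σ := by
  unfold disorderWeight
  refine Real.exp_le_exp.2 ?_
  have hsum : |∑ b ∈ S, spinAt b.1 σ * spinAt (b.1 + Pi.single b.2 1) σ| ≤ #S := by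
    calc |∑ b ∈ S, spinAt b.1 σ * spinAt (b.1 + Pi.single b.2 1) σ|
        ≤ ∑ b ∈ S, |spinAt b.1 σ * spinAt (b.1 + Pi.single b.2 1) σ| :=
          Finset.abs_sum_le_sum_abs _ _
      _ = #S := by simp [abs_mul]
  have hβ : β * ∑ b ∈ S, spinAt b.1 σ * spinAt (b.1 + Pi.single b.2 1) σ ≤ |β| * #S :=
    (le_abs_self _).trans (by rw [abs_mul]; exact mul_le_mul_of_nonneg_left hsum (abs_nonneg β))
  linarith

/-- **The normalisation is positive**: `⟨w_S⟩⁺_{β,h} ≥ e^{-2|β||S|} > 0` for `β, h ≥ 0`, so the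
twisted plus state of a spin product is a genuine quotient of limits. [folklore] -/
theorem plusExpect_disorderWeight_pos {β h : ℝ} (hβ : 0 ≤ β) (hh : 0 ≤ h)
    (S : Finset (Site d × Fin d)) : 0 < plusExpect d β h (disorderWeight S β) := by
  refine lt_of_lt_of_le (Real.exp_pos (-(2 * |β| * #S)))
    (ge_of_tendsto' (tendsto_isingExpect_plus_disorderWeight hβ hh S) fun L => ?_)
  calc Real.exp (-(2 * |β| * #S))
      = isingExpect (zdGraph d) (box d L) β h .plus fun _ => Real.exp (-(2 * |β| * #S)) :=
        (isingExpect_const _ _ _ _ _ _).symm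
    _ ≤ isingExpect (zdGraph d) (box d L) β h .plus (disorderWeight S β) :=
        isingExpect_mono_fun (zdGraph d) (box d L) β h .plus measurable_const
          (measurable_disorderWeight S β) fun σ => exp_neg_le_disorderWeight S β σ

/-- `⟨1⟩_S = 1` for `β, h ≥ 0`. [folklore] -/
theorem twistedPlusExpect_one {β h : ℝ} (hβ : 0 ≤ β) (hh : 0 ≤ h) (S : Finset (Site d × Fin d)) :
    twistedPlusExpect d β h S (fun _ => 1) = 1 := by
  have h1 : (fun σ => (1 : ℝ) * disorderWeight S β σ) = disorderWeight S β := funext fun σ => one_mul _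
  rw [twistedPlusExpect, h1, div_self (plusExpect_disorderWeight_pos hβ hh S).ne']

/-- **`|⟨σ_A⟩_S| ≤ 1`** for `β, h ≥ 0`: the twisted plus state of a spin product is a genuine,
bounded ratio of limits. [folklore] -/
theorem abs_twistedPlusExpect_spinProduct_le_one {β h : ℝ} (hβ : 0 ≤ β) (hh : 0 ≤ h)
    (S : Finset (Site d × Fin d)) (A : Finset (Site d)) :
    |twistedPlusExpect d β h S (spinProduct A)| ≤ 1 :=
  abs_twistedPlusExpect_le (fun σ => abs_spinProduct_le_one A σ)
    ⟨_, tendsto_isingExpect_plus_spinProduct_mul_disorderWeight hβ hh A S⟩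
    ⟨_, tendsto_isingExpect_plus_disorderWeight hβ hh S⟩

end Literature.Probability.LatticeModels
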